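import Summits.AnomalousDissipation.AnomalousDissipation.Theorems.TwohalfdNeg.Negative.LaminarShear
import Literature.Analysis.FluidPDE.LongTimeAverageSubadditive
import Mathlib.Analysis.SpecialFunctions.ExpDeriv

/-!
# Negative knowledge for the crux `RestMeanFloorTG` (stmt-AnomalousDissipation-24255, route `RootDecompCycle1`):
# the CLASS I separating model — the Stokes spin-up from rest under a shear force is loud AND energy-unbounded

Birth-certificate witness BC5 («strictly weaker than S») of the OR-1 spin-up dichotomy, class I (laminar-integrable
force), in KERNEL form (previously PLAN-ONLY; `∃`-form of the lens-2 aside `ShearFromRestLoudUnbounded`, which uses the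
congruent force `sin(2πx₁)e₀`).  Under the tree's unit vertical shear force `shear 0 1 = (0,0,cos 2πx₀)`
(`Theorems/TwohalfdNeg/Negative/LaminarShear.lean`) the explicit Stokes spin-up FROM REST
`u_ν(t,x) = (1 − e^{−4π²νt})(4π²ν)⁻¹ (0,0,cos 2πx₀)` is a classical solution of NS_ν with zero pressure
(`(u·∇)u = 0`; `∂ₜu − νΔu = f` on the single mode), hence a GLOBAL LERAY–HOPF SOLUTION FROM THE ZERO DATUM
(`Torus.IsClassicalNSSolutionOn.isGlobalLerayHopf`, proved in tree), with honest limsup means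
`⟨ν‖∇u_ν‖²⟩ ≥ 1/(64π²ν)` and `⟨‖u_ν‖²⟩ ≥ 1/(256π⁴ν²)` (`a(t) = A(1 − e^{−ct}) ≥ A/2` for `t ≥ 1/c` and the
Cesàro floor `half_le_longTimeAvgSup`).  More generally every amplitude-modulated shear `t ↦ shear 0 (a t)`, `a`
smooth, is a classical solution with force `shear 0 (a' + 4π²ν a)` (`isClassicalNSSolutionOn_ampShear`).  In the exact
quantifier SHAPES of the route items (datum pinned to `0`, `∃`/`∀` over global Leray–Hopf solutions, limsup means), at
the shear force: the FLOOR shape of `RestMeanFloorTG` (24255) HOLDS (`restMeanFloor_shape_shear`), the CEILING shape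
of `RestMeanCeilingTG` (24256) FAILS (`not_restMeanCeiling_shape_shear`), and the LOUD CEILING shape of
`LoudRestMeanCeilingTG` (33849) FAILS (`not_loudRestMeanCeiling_shape_shear`; the route docstring's «NOT FREE … in
kind, OR-1 BC5(ii)»).  So «floor-shape ⇏ (loud) ceiling-shape» is theorem-grade — the class-I half of the separating
pair whose class-II half (swept shear: ceiling TRUE, floor FALSE) is `Theorems.CorrelationEnergyUnboundedNeg_refuted`.
The `∀`-form («every Leray–Hopf solution from rest IS this flow») needs forced weak–strong uniqueness on `T³` (not in
tree) and is not claimed.  NOT a refutation of any item (the items are pinned at the Taylor–Green force); asserts no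
route statement.  Supports stmt-AnomalousDissipation-24255.  [decomp-ad crit-1 g15]  References: Temam,
*Navier–Stokes Equations* (1979), Ch. III §3; Doering–Foias, J. Fluid Mech. 467 (2002), §2–3 (laminar vs. turbulent
scaling of `⟨ν‖∇u‖²⟩`).
-/

noncomputable section
-- the mandated namespace `Summit.<Summit>.<Problem>.Theorems` repeats `AnomalousDissipation` (single-problem summit)
set_option linter.dupNamespace false

namespace Summit.AnomalousDissipation.AnomalousDissipation.Theorems.RestMeanFloorTG.Negative

open MeasureTheory Set Filter Topology UnitAddTorus
open scoped ENNReal NNReal InnerProductSpace ContDiff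
open Literature.Analysis.FunctionSpaces Literature.Analysis.FunctionSpaces.Torus
open Literature.Analysis.FluidPDE Literature.Analysis.FluidPDE.Torus
open Summit.AnomalousDissipation.AnomalousDissipation.Theorems.TwohalfdNeg.Negative

/-! ## 1. A Cesàro floor: an eventual pointwise floor bounds the `limsup` long-time mean from below -/
/-- **Cesàro floor.** If `g ≥ 0` is continuous, bounded by `B` on `(0, ∞)` (so that the running means are
honestly bounded) and `g ≥ K ≥ 0` on `[t₀, ∞)`, `t₀ ≥ 0`, then `⟨g⟩ ≥ K/2`: for `T ≥ 2t₀`,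
`T⁻¹∫₀ᵀ g ≥ T⁻¹ K (T − t₀) ≥ K/2`. [folklore] -/
theorem half_le_longTimeAvgSup {g : ℝ → ℝ} {B K t₀ : ℝ} (hgc : Continuous g) (hg0 : ∀ t, 0 ≤ g t)
    (hgB : ∀ t, 0 < t → g t ≤ B) (ht₀ : 0 ≤ t₀) (hK : 0 ≤ K) (hge : ∀ t, t₀ ≤ t → K ≤ g t) :
    K / 2 ≤ longTimeAvgSup g := by
  have hB : 0 ≤ B := (hg0 1).trans (hgB 1 one_pos)
  have hbdd : IsBoundedUnder (· ≤ ·) atTop (timeMean g) := by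
    refine ⟨B, ?_⟩
    rw [Filter.eventually_map]
    filter_upwards [eventually_gt_atTop (0 : ℝ)] with T hT
    have hmean : timeMean (fun _ => B) T = B := by
      unfold timeMean
      rw [intervalIntegral.integral_const, smul_eq_mul, sub_zero, ← mul_assoc, inv_mul_cancel₀ hT.ne', one_mul]
    calc timeMean g T ≤ timeMean (fun _ => B) T :=
          timeMean_mono_of_nonneg (g := fun _ => B) hT.le (fun _ => hB)
            (integrableOn_const (hs := measure_Ioc_lt_top.ne)) (fun t ht _ => hgB t ht)
      _ = B := hmean
  have hlow : ∀ᶠ T in atTop, K / 2 ≤ timeMean g T := by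
    filter_upwards [eventually_ge_atTop (2 * t₀), eventually_gt_atTop (0 : ℝ)] with T hT2 hT0
    have ht₀T : t₀ ≤ T := by linarith
    have hsplit : ∫ t in (0 : ℝ)..T, g t = (∫ t in (0 : ℝ)..t₀, g t) + ∫ t in t₀..T, g t :=
      (intervalIntegral.integral_add_adjacent_intervals (hgc.intervalIntegrable _ _)
        (hgc.intervalIntegrable _ _)).symm
    have h1 : 0 ≤ ∫ t in (0 : ℝ)..t₀, g t := intervalIntegral.integral_nonneg ht₀ fun t _ => hg0 t
    have h2 : (T - t₀) * K ≤ ∫ t in t₀..T, g t := by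
      have h := intervalIntegral.integral_mono_on (μ := volume) ht₀T
        ((continuous_const : Continuous fun _ : ℝ => K).intervalIntegrable _ _)
        (hgc.intervalIntegrable _ _) (fun t ht => hge t ht.1)
      rwa [intervalIntegral.integral_const, smul_eq_mul] at h
    have h3 : K * (T / 2) ≤ (∫ t in (0 : ℝ)..t₀, g t) + ∫ t in t₀..T, g t := by
      have : K * (T / 2) ≤ K * (T - t₀) := mul_le_mul_of_nonneg_left (by linarith) hK
      linarith
    unfold timeMean
    rw [hsplit, inv_mul_eq_div, le_div_iff₀ hT0]
    linarith
  show K / 2 ≤ limsup (timeMean g) atTop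
  exact le_limsup_of_frequently_le hlow.frequently hbdd

/-! ## 2. The spin-up amplitude `a(t) = A (1 − e^{−ct})` (solution of `a' + c a = c A`, `a(0) = 0`) -/
/-- `a` is smooth. [folklore] -/
theorem contDiff_amp (c A : ℝ) : ContDiff ℝ ∞ (fun s : ℝ => A * (1 - Real.exp (-(c * s)))) :=
  contDiff_const.mul (contDiff_const.sub ((contDiff_const.mul contDiff_id).neg.exp))

/-- `a'(t) = A c e^{−ct}`. [folklore] -/
theorem hasDerivAt_amp (c A t : ℝ) :
    HasDerivAt (fun s : ℝ => A * (1 - Real.exp (-(c * s)))) (A * (c * Real.exp (-(c * t)))) t := by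
  have h1 : HasDerivAt (fun s : ℝ => -(c * s)) (-(c * 1)) t := ((hasDerivAt_id' t).const_mul c).neg
  have h2 : HasDerivAt (fun s : ℝ => 1 - Real.exp (-(c * s))) (0 - Real.exp (-(c * t)) * -(c * 1)) t :=
    (hasDerivAt_const t 1).sub h1.exp
  exact (h2.const_mul A).congr_deriv (by ring)

/-- `0 ≤ a(t)` for `t ≥ 0` (`c, A ≥ 0`). [folklore] -/
theorem amp_nonneg {c A t : ℝ} (hc : 0 ≤ c) (hA : 0 ≤ A) (ht : 0 ≤ t) : 0 ≤ A * (1 - Real.exp (-(c * t))) :=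
  mul_nonneg hA (sub_nonneg.2 (Real.exp_le_one_iff.2 (neg_nonpos.2 (mul_nonneg hc ht))))

/-- `a(t) ≤ A` (`A ≥ 0`). [folklore] -/
theorem amp_le {c A : ℝ} (hA : 0 ≤ A) (t : ℝ) : A * (1 - Real.exp (-(c * t))) ≤ A := by
  have : 0 < Real.exp (-(c * t)) := Real.exp_pos _
  nlinarith

/-- `a(t) ≥ A/2` for `t ≥ 1/c` (`e^{−ct} ≤ e^{−1} ≤ 1/2`). [folklore] -/
theorem half_le_amp {c A t : ℝ} (hc : 0 < c) (hA : 0 ≤ A) (ht : c⁻¹ ≤ t) :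
    A / 2 ≤ A * (1 - Real.exp (-(c * t))) := by
  have h1 : 1 ≤ c * t := by
    have := mul_le_mul_of_nonneg_left ht hc.le
    rwa [mul_inv_cancel₀ hc.ne'] at this
  have hexp1 : (2 : ℝ) ≤ Real.exp 1 := by
    have := Real.add_one_le_exp (1 : ℝ)
    norm_num at this
    exact this
  have h2 : Real.exp (-(c * t)) ≤ 1 / 2 :=
    calc Real.exp (-(c * t)) ≤ Real.exp (-1) := Real.exp_le_exp.2 (by linarith)
      _ = (Real.exp 1)⁻¹ := Real.exp_neg 1
      _ ≤ 2⁻¹ := inv_anti₀ two_pos hexp1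
      _ = 1 / 2 := by norm_num
  have h3 := mul_le_mul_of_nonneg_left h2 hA
  nlinarith

/-- The engine: `⟨M a(t)²⟩ ≥ M A²/8` (`a ≥ A/2` from `t = 1/c` on, Cesàro floor). [folklore] -/
theorem longTimeAvgSup_amp_sq_ge {c A M : ℝ} (hc : 0 < c) (hA : 0 ≤ A) (hM : 0 ≤ M) :
    M * A ^ 2 / 8 ≤ longTimeAvgSup (fun t => M * (A * (1 - Real.exp (-(c * t)))) ^ 2) := by
  have hcont : Continuous (fun t => M * (A * (1 - Real.exp (-(c * t)))) ^ 2) := by fun_prop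
  have h0 : ∀ t, 0 ≤ M * (A * (1 - Real.exp (-(c * t)))) ^ 2 := fun t => mul_nonneg hM (sq_nonneg _)
  have hB : ∀ t, 0 < t → M * (A * (1 - Real.exp (-(c * t)))) ^ 2 ≤ M * A ^ 2 := fun t ht =>
    mul_le_mul_of_nonneg_left (pow_le_pow_left₀ (amp_nonneg hc.le hA ht.le) (amp_le hA t) 2) hM
  have hK : ∀ t, c⁻¹ ≤ t → M * A ^ 2 / 4 ≤ M * (A * (1 - Real.exp (-(c * t)))) ^ 2 := fun t ht => by
    have h' : (A / 2) ^ 2 ≤ (A * (1 - Real.exp (-(c * t)))) ^ 2 :=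
      pow_le_pow_left₀ (by positivity) (half_le_amp hc hA ht) 2
    calc M * A ^ 2 / 4 = M * (A / 2) ^ 2 := by ring
      _ ≤ M * (A * (1 - Real.exp (-(c * t)))) ^ 2 := mul_le_mul_of_nonneg_left h' hM
  have h := half_le_longTimeAvgSup hcont h0 hB (inv_nonneg.2 hc.le) (by positivity) hK
  linarith

/-! ## 3. Amplitude-modulated vertical shears `t ↦ shear 0 (a t) = (0, 0, a(t) cos 2πx₀)` -/
/-- `(0, 0, c · cos 2πy₀)` as a `2½`-dimensional field is the laminar state `shear 0 c`. [folklore] -/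
theorem twoHalf_mulProfile (c : ℝ) :
    twoHalf (0 : UnitAddTorus (Fin 2) → EuclideanSpace ℝ (Fin 2)) (fun y => c * profile 0 1 y) = shear 0 c := by
  have h : (fun y => c * profile 0 1 y) = profile 0 c := funext fun y => by rw [← profile_mul, mul_one]
  rw [h]
  rfl

/-- The profile `(t, y) ↦ a(t) cos 2πy₀` is jointly smooth for smooth `a`. [folklore] -/
theorem isSmoothSpaceTimeOn_mulProfile (a : ℝ → ℝ) (ha : ContDiff ℝ ∞ a) :
    Literature.Analysis.FunctionSpaces.Torus.IsSmoothSpaceTimeOn univ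
      (fun t (y : UnitAddTorus (Fin 2)) => a t * profile 0 1 y) := by
  have h1 : Literature.Analysis.FunctionSpaces.Torus.IsSmoothSpaceTimeOn univ
      (fun t (_ : UnitAddTorus (Fin 2)) => a t) := by
    unfold Literature.Analysis.FunctionSpaces.Torus.IsSmoothSpaceTimeOn
    have : stLift (fun t (_ : UnitAddTorus (Fin 2)) => a t) = a ∘ Prod.fst := by
      funext p
      rfl
    rw [this]
    exact (ha.comp contDiff_fst).contDiffOn
  have h2 : Literature.Analysis.FunctionSpaces.Torus.IsSmoothSpaceTimeOn univ (fun (_ : ℝ) => profile 0 1) :=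
    isSmoothSpaceTimeOn_const (isSmooth_profile 0 1) _
  exact h1.mul h2

/-- `∂ₜ(a(t) cos 2πy₀) = a'(t) cos 2πy₀`. [folklore] -/
theorem timeDerivWithin_mulProfile (a : ℝ → ℝ) (t : ℝ) (y : UnitAddTorus (Fin 2)) :
    Literature.Analysis.FunctionSpaces.Torus.timeDerivWithin univ
      (fun t (y : UnitAddTorus (Fin 2)) => a t * profile 0 1 y) t y = deriv a t * profile 0 1 y := by
  unfold Literature.Analysis.FunctionSpaces.Torus.timeDerivWithin
  rw [derivWithin_univ]
  exact deriv_mul_const_field _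

/-- `Δ(c cos 2πy₀) = −4π² c cos 2πy₀`. [folklore] -/
theorem laplacian_mulProfile (c : ℝ) (y : UnitAddTorus (Fin 2)) :
    Torus.laplacian (fun y : UnitAddTorus (Fin 2) => c * profile 0 1 y) y = -(4 * Real.pi ^ 2) * (c * profile 0 1 y) := by
  have h : (fun y : UnitAddTorus (Fin 2) => c * profile 0 1 y) = profile 0 c :=
    funext fun y => by rw [← profile_mul, mul_one]
  have hp : profile 0 c y = c * profile 0 1 y := by rw [← profile_mul, mul_one]
  rw [h, laplacian_profile, hp]
  simp

/-- **The residual force of the ansatz `(0, 0, a(t) cos 2πx₀)` (zero planar part, zero pressure) is the shear force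
`shear 0 (a'(t) + 4π²ν a(t))`.** [folklore] -/
theorem twoHalfForce_mulProfile (a : ℝ → ℝ) (ν : ℝ) :
    twoHalfForce univ ν (fun _ => (0 : UnitAddTorus (Fin 2) → EuclideanSpace ℝ (Fin 2)))
      (fun t (y : UnitAddTorus (Fin 2)) => a t * profile 0 1 y) (fun _ _ => (0 : ℝ)) =
      fun t => shear 0 (deriv a t + 4 * Real.pi ^ 2 * ν * a t) := by
  funext t x
  rw [twoHalfForce_apply, shear]
  have h1 : (fun y => Literature.Analysis.FunctionSpaces.Torus.timeDerivWithin univ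
      (fun _ : ℝ => (0 : UnitAddTorus (Fin 2) → EuclideanSpace ℝ (Fin 2))) t y +
      Torus.convect ((fun _ : ℝ => (0 : UnitAddTorus (Fin 2) → EuclideanSpace ℝ (Fin 2))) t)
        ((fun _ : ℝ => (0 : UnitAddTorus (Fin 2) → EuclideanSpace ℝ (Fin 2))) t) y -
      ν • Torus.laplacian ((fun _ : ℝ => (0 : UnitAddTorus (Fin 2) → EuclideanSpace ℝ (Fin 2))) t) y +
      Torus.gradient ((fun _ _ => (0 : ℝ)) t) y) = (0 : UnitAddTorus (Fin 2) → EuclideanSpace ℝ (Fin 2)) := by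
    funext y
    simp only [timeDerivWithin_const_fun, convect_zero₂, laplacian_zero₂, gradient_zero₂, smul_zero]
    simp
  have h2 : (fun y => Literature.Analysis.FunctionSpaces.Torus.timeDerivWithin univ
      (fun t (y : UnitAddTorus (Fin 2)) => a t * profile 0 1 y) t y +
      ⟪((fun _ : ℝ => (0 : UnitAddTorus (Fin 2) → EuclideanSpace ℝ (Fin 2))) t) y,
        Torus.gradient ((fun t (y : UnitAddTorus (Fin 2)) => a t * profile 0 1 y) t) y⟫_ℝ -
      ν * Torus.laplacian ((fun t (y : UnitAddTorus (Fin 2)) => a t * profile 0 1 y) t) y) =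
      TwohalfdNeg.Negative.profile 0 (deriv a t + 4 * Real.pi ^ 2 * ν * a t) := by
    funext y
    have hp : TwohalfdNeg.Negative.profile 0 (deriv a t + 4 * Real.pi ^ 2 * ν * a t) y =
        (deriv a t + 4 * Real.pi ^ 2 * ν * a t) * profile 0 1 y := by
      rw [← profile_mul, mul_one]
    rw [timeDerivWithin_mulProfile, hp]
    simp only [laplacian_mulProfile, Pi.zero_apply, inner_zero_left]
    ring
  rw [h1, h2]

/-- **Every amplitude-modulated shear is a classical Navier–Stokes solution** on `ℝ × T³`: viscosity `ν`, zero
pressure, force `shear 0 (a' + 4π²ν a)` (`Torus.isClassicalNSSolutionOn_twoHalf`, vanishing planar part). [folklore] -/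
theorem isClassicalNSSolutionOn_ampShear (a : ℝ → ℝ) (ha : ContDiff ℝ ∞ a) (ν : ℝ) :
    IsClassicalNSSolutionOn univ ν (fun t => shear 0 (deriv a t + 4 * Real.pi ^ 2 * ν * a t))
      (fun t => shear 0 (a t)) (fun _ => (fun _ : UnitAddTorus (Fin 2) => (0 : ℝ)) ∘ planarProj) := by
  have hV : Literature.Analysis.FunctionSpaces.Torus.IsSmoothSpaceTimeOn univ
      (fun _ : ℝ => (0 : UnitAddTorus (Fin 2) → EuclideanSpace ℝ (Fin 2))) :=
    isSmoothSpaceTimeOn_const isSmooth_zero₂ _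
  have hφ : Literature.Analysis.FunctionSpaces.Torus.IsSmoothSpaceTimeOn univ
      (fun _ : ℝ => fun _ : UnitAddTorus (Fin 2) => (0 : ℝ)) :=
    isSmoothSpaceTimeOn_const (isSmooth_const (0 : ℝ)) _
  have hcl := isClassicalNSSolutionOn_twoHalf uniqueDiffOn_univ ν hV (isSmoothSpaceTimeOn_mulProfile a ha) hφ
    (fun _ _ x => by simp [Torus.divergence, Torus.partialDeriv, Torus.lineDeriv])
  have hu : (fun t => twoHalf ((fun _ : ℝ => (0 : UnitAddTorus (Fin 2) → EuclideanSpace ℝ (Fin 2))) t)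
      ((fun t (y : UnitAddTorus (Fin 2)) => a t * profile 0 1 y) t)) = fun t => shear 0 (a t) :=
    funext fun t => twoHalf_mulProfile (a t)
  rw [twoHalfForce_mulProfile, hu] at hcl
  exact hcl

/-- **An amplitude-modulated shear from rest is a global Leray–Hopf solution from the ZERO datum** for the steady
force `shear 0 b` whenever `a(0) = 0` and `a' + 4π²ν a ≡ b` (classical ⇒ Leray–Hopf on `T³`,
`Torus.IsClassicalNSSolutionOn.isGlobalLerayHopf`). [folklore] -/
theorem isGlobalLerayHopf_ampShear (a : ℝ → ℝ) (ha : ContDiff ℝ ∞ a) (ha0 : a 0 = 0) {ν b : ℝ}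
    (hb : ∀ t, deriv a t + 4 * Real.pi ^ 2 * ν * a t = b) :
    IsGlobalLerayHopf ν (fun _ => shear 0 b) 0 (fun t => shear 0 (a t)) := by
  have hcl := isClassicalNSSolutionOn_ampShear a ha ν
  have hf : (fun t => shear 0 (deriv a t + 4 * Real.pi ^ 2 * ν * a t)) =
      fun _ => shear 0 b := funext fun t => by rw [hb t]
  rw [hf] at hcl
  have h0 : shear 0 (a 0) = (0 : UnitAddTorus (Fin 3) → EuclideanSpace ℝ (Fin 3)) := by
    rw [ha0]
    funext x
    have h := norm_shear_le 0 0 x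
    rw [abs_zero] at h
    rw [Pi.zero_apply]
    exact norm_le_zero_iff.1 h
  have h := hcl.isGlobalLerayHopf
  simpa only [h0] using h

/-! ## 4. The Stokes spin-up `a(t) = A(1 − e^{−ct})`: honest lower bounds on the long-time means -/
/-- **Mean energy floor**: `⟨‖u‖²⟩ ≥ A²/16` for `u(t) = shear 0 (A(1 − e^{−ct}))`, `c > 0`, `A ≥ 0`. [folklore] -/
theorem meanEnergy_spinUp_ge {c A : ℝ} (hc : 0 < c) (hA : 0 ≤ A) :
    A ^ 2 / 16 ≤ meanEnergy (fun t => shear 0 (A * (1 - Real.exp (-(c * t))))) := by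
  rw [meanEnergy_eq_longTimeAvgSup]
  have h : (fun t => ∫ x, ‖shear 0 (A * (1 - Real.exp (-(c * t)))) x‖ ^ 2) =
      fun t => (1 / 2) * (A * (1 - Real.exp (-(c * t)))) ^ 2 := by
    funext t
    rw [integral_norm_sq_shear]
    ring
  rw [h]
  have := longTimeAvgSup_amp_sq_ge hc hA (by norm_num : (0 : ℝ) ≤ 1 / 2)
  linarith

/-- **Mean dissipation floor**: `⟨ν‖∇u‖²⟩ ≥ 2π²ν A²/8` for `u(t) = shear 0 (A(1 − e^{−ct}))`. [folklore] -/
theorem meanDissipation_spinUp_ge {ν c A : ℝ} (hν : 0 ≤ ν) (hc : 0 < c) (hA : 0 ≤ A) :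
    ν * (2 * Real.pi ^ 2) * A ^ 2 / 8 ≤ meanDissipation ν (fun t => shear 0 (A * (1 - Real.exp (-(c * t))))) := by
  unfold meanDissipation
  have h : (fun t => ν * (eGradNormSq (shear 0 (A * (1 - Real.exp (-(c * t)))))).toReal) =
      fun t => (ν * (2 * Real.pi ^ 2)) * (A * (1 - Real.exp (-(c * t)))) ^ 2 := by
    funext t
    rw [toReal_eGradNormSq_shear]
    simp only [Nat.cast_zero, zero_add, one_pow, mul_one]
    ring
  rw [h]
  exact longTimeAvgSup_amp_sq_ge hc hA (by positivity)

/-! ## 5. The class I witness at the unit shear force `shear 0 1 = (0, 0, cos 2πx₀)` -/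
/-- **The Stokes spin-up from rest** `u_ν(t) = shear 0 ((4π²ν)⁻¹(1 − e^{−4π²νt}))` is a global Leray–Hopf solution
from the zero datum under the unit shear force `shear 0 1`. [folklore] -/
theorem isGlobalLerayHopf_spinUp_unit {ν : ℝ} (hν : 0 < ν) :
    IsGlobalLerayHopf ν (fun _ => shear 0 1) 0
      (fun t => shear 0 ((4 * Real.pi ^ 2 * ν)⁻¹ * (1 - Real.exp (-(4 * Real.pi ^ 2 * ν * t))))) := by
  refine isGlobalLerayHopf_ampShear _ (contDiff_amp _ _) (by simp) fun t => ?_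
  rw [(hasDerivAt_amp (4 * Real.pi ^ 2 * ν) (4 * Real.pi ^ 2 * ν)⁻¹ t).deriv]
  have hc : 4 * Real.pi ^ 2 * ν ≠ 0 := by positivity
  field_simp
  ring

/-- Choice of a small viscosity beating a prescribed energy level. [folklore] -/
theorem exists_small_viscosity {c ν₀ : ℝ} (hc : 0 < c) (hν₀ : 0 < ν₀) (E : ℝ) :
    ∃ ν : ℝ, 0 < ν ∧ ν < ν₀ ∧ E < c / ν ∧ c / ν ≤ c / ν ^ 2 ∧ c ≤ c / ν := by
  set ν := min (ν₀ / 2) (min (1 / 2) (c / (|E| + 1))) with hνdef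
  have hE1 : 0 < |E| + 1 := by positivity
  have hν : 0 < ν := lt_min (by linarith) (lt_min (by norm_num) (div_pos hc hE1))
  have hνν₀ : ν < ν₀ := (min_le_left _ _).trans_lt (by linarith)
  have hν1 : ν ≤ 1 := ((min_le_right _ _).trans (min_le_left _ _)).trans (by norm_num)
  have hνc : ν ≤ c / (|E| + 1) := (min_le_right _ _).trans (min_le_right _ _)
  have hcν : |E| + 1 ≤ c / ν := by
    rw [le_div_iff₀ hν]
    rw [le_div_iff₀ hE1] at hνc
    linarith
  have hE' : E < c / ν := lt_of_lt_of_le (lt_of_le_of_lt (le_abs_self E) (lt_add_one _)) hcν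
  have h0 : 0 ≤ c / ν := (div_pos hc hν).le
  have hsq : c / ν ≤ c / ν ^ 2 := by
    rw [sq, ← div_div, le_div_iff₀ hν]
    exact mul_le_of_le_one_right h0 hν1
  have hcc : c ≤ c / ν := by
    rw [le_div_iff₀ hν]
    exact mul_le_of_le_one_right hc.le hν1
  exact ⟨ν, hν, hνν₀, hE', hsq, hcc⟩

/-- **CLASS I SEPARATING MODEL (`∃`-form of the aside `ShearFromRestLoudUnbounded`).** Under the unit shear force
`shear 0 1`, for every `ν > 0` some global Leray–Hopf solution FROM REST (the Stokes spin-up) has limsup-mean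
dissipation `≥ c/ν` and limsup-mean energy `≥ c/ν²`, `c = 1/(256π⁴)`: loud AND energy-unbounded. [folklore] -/
theorem shearSpinUp_loud_unbounded :
    ∃ c : ℝ, 0 < c ∧ ∀ ν : ℝ, 0 < ν →
      ∃ u : ℝ → UnitAddTorus (Fin 3) → EuclideanSpace ℝ (Fin 3), IsGlobalLerayHopf ν (fun _ => shear 0 1) 0 u ∧
        c / ν ≤ meanDissipation ν u ∧ c / ν ^ 2 ≤ meanEnergy u := by
  refine ⟨1 / (256 * Real.pi ^ 4), by positivity, fun ν hν => ?_⟩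
  have hc : 0 < 4 * Real.pi ^ 2 * ν := by positivity
  have hA : 0 ≤ (4 * Real.pi ^ 2 * ν)⁻¹ := inv_nonneg.2 hc.le
  have hν0 : ν ≠ 0 := hν.ne'
  have hπ : Real.pi ≠ 0 := Real.pi_ne_zero
  have hπ1 : 1 ≤ 4 * Real.pi ^ 2 := by nlinarith [Real.pi_gt_three]
  have key : 64 * Real.pi ^ 2 * ν ≤ 256 * Real.pi ^ 4 * ν :=
    calc 64 * Real.pi ^ 2 * ν = 64 * Real.pi ^ 2 * ν * 1 := by ring
      _ ≤ 64 * Real.pi ^ 2 * ν * (4 * Real.pi ^ 2) := mul_le_mul_of_nonneg_left hπ1 (by positivity)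
      _ = 256 * Real.pi ^ 4 * ν := by ring
  refine ⟨_, isGlobalLerayHopf_spinUp_unit hν, le_trans ?_ (meanDissipation_spinUp_ge hν.le hc hA),
    le_trans ?_ (meanEnergy_spinUp_ge hc hA)⟩
  · calc 1 / (256 * Real.pi ^ 4) / ν = 1 / (256 * Real.pi ^ 4 * ν) := by rw [div_div]
      _ ≤ 1 / (64 * Real.pi ^ 2 * ν) := one_div_le_one_div_of_le (by positivity) key
      _ = ν * (2 * Real.pi ^ 2) * ((4 * Real.pi ^ 2 * ν)⁻¹) ^ 2 / 8 := by
          field_simp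
          ring
  · exact le_of_eq (by field_simp; ring)

/-- **The FLOOR shape of `RestMeanFloorTG` (24255) HOLDS at the shear force** (`ε = 1/(256π⁴)`, `ν₁ = 1`: for every
`ν ∈ (0, 1)` SOME global Leray–Hopf solution from rest under `shear 0 1` has `⟨ν‖∇u‖²⟩ ≥ ε`). [folklore] -/
theorem restMeanFloor_shape_shear :
    ∃ ε ν₁ : ℝ, 0 < ε ∧ 0 < ν₁ ∧ ∀ ν : ℝ, 0 < ν → ν < ν₁ →
      ∃ u : ℝ → UnitAddTorus (Fin 3) → EuclideanSpace ℝ (Fin 3),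
        IsGlobalLerayHopf ν (fun _ => shear 0 1) 0 u ∧ ε ≤ meanDissipation ν u := by
  obtain ⟨c, hc, h⟩ := shearSpinUp_loud_unbounded
  refine ⟨c, 1, hc, one_pos, fun ν hν hν1 => ?_⟩
  obtain ⟨u, hu, hD, -⟩ := h ν hν
  refine ⟨u, hu, le_trans ?_ hD⟩
  rw [le_div_iff₀ hν]
  nlinarith

/-- **The CEILING shape of `RestMeanCeilingTG` (24256) FAILS at the shear force**: no `ν`-uniform bound on the
limsup-mean energy of ALL Leray–Hopf solutions from rest under `shear 0 1` («floor ⇏ ceiling»). [folklore] -/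
theorem not_restMeanCeiling_shape_shear :
    ¬ ∃ E ν₀ : ℝ, 0 < ν₀ ∧ ∀ ν : ℝ, 0 < ν → ν < ν₀ →
        ∀ u : ℝ → UnitAddTorus (Fin 3) → EuclideanSpace ℝ (Fin 3),
          IsGlobalLerayHopf ν (fun _ => shear 0 1) 0 u → meanEnergy u ≤ E := by
  rintro ⟨E, ν₀, hν₀, hE⟩
  obtain ⟨c, hc, h⟩ := shearSpinUp_loud_unbounded
  obtain ⟨ν, hν, hνν₀, hEν, hsq, -⟩ := exists_small_viscosity hc hν₀ E
  obtain ⟨u, hu, -, hEn⟩ := h ν hν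
  have hle := hE ν hν hνν₀ u hu
  linarith

/-- **The LOUD CEILING shape of `LoudRestMeanCeilingTG` (33849) FAILS at the shear force**: the Stokes spin-up under
`shear 0 1` is `c`-loud for `ν ≤ 1` with `⟨‖u‖²⟩ ≥ c/ν²` («loud spin-ups are bounded» fails in kind). [folklore] -/
theorem not_loudRestMeanCeiling_shape_shear :
    ¬ ∀ ε : ℝ, 0 < ε → ∃ E ν₀ : ℝ, 0 < ν₀ ∧ ∀ ν : ℝ, 0 < ν → ν < ν₀ →
        ∀ u : ℝ → UnitAddTorus (Fin 3) → EuclideanSpace ℝ (Fin 3),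
          IsGlobalLerayHopf ν (fun _ => shear 0 1) 0 u → ε ≤ meanDissipation ν u → meanEnergy u ≤ E := by
  intro hL
  obtain ⟨c, hc, h⟩ := shearSpinUp_loud_unbounded
  obtain ⟨E, ν₀, hν₀, hE⟩ := hL c hc
  obtain ⟨ν, hν, hνν₀, hEν, hsq, hcc⟩ := exists_small_viscosity hc hν₀ E
  obtain ⟨u, hu, hD, hEn⟩ := h ν hν
  have hle := hE ν hν hνν₀ u hu (hcc.trans hD)
  linarith

end Summit.AnomalousDissipation.AnomalousDissipation.Theorems.RestMeanFloorTG.Negative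

end
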